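import Literature.Algebra.Polynomial.GramMatrixMethod
import Literature.NumberTheory.QuadraticForms.HasseMinkowskiDiagonal
import HarnessLib

/-!
# Rational Gram matrices give rational (weighted) sums of squares: Peyrl–Parrilo, Prop. 4 and Thm 6

Topic `Algebra/Polynomial`; namespace `Literature.Algebra.Polynomial.OrderedFieldGramSos`.  Everything
here is PROVED (no named fact, no `sorry`, no instance, no notation); two private plumbing lemmas
(`posSemidef_iff_isSymm_and`, `isSumSq_map`).

SOURCE (read from the held text `paper:doi-10-1016-j-tcs-2008-09-025`, pp. 274–275): H. Peyrl,
P. A. Parrilo, *Computing sum of squares decompositions with rational coefficients*, Theoret. Comput.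
Sci. 409 (2008) 269–281, §3:

* **Proposition 4.** "The existence of a rational SOS decomposition, i.e., `p(x) = Σᵢ pᵢ(x)²` where
  `pᵢ(x) ∈ ℚ[x]`, is equivalent to the existence of a Gram matrix with rational entries."  Proof
  (loc. cit.): "Using diagonalization of quadratic forms over a field … the quadratic form `zᵀQz` can
  be written as a weighted sum of squares in `ℚ[x]`: `p(x) = zᵀQz = zᵀPᵀDPz = Σᵢ dᵢ (Pz)ᵢ²` … The
  rational weights `dᵢ` are nonnegative because `Q` was assumed to be positive semidefinite.  Observe
  that `dᵢ = aᵢ/bᵢ = aᵢbᵢ/bᵢ²`.  Hence `p(x)` can be written as a sum of at most `a₁b₁ + ⋯ + a_k b_k`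
  squares in `ℚ[x]`.  Conversely, if `p(x)` can be written as a sum of squared polynomials in `ℚ[x]`,
  there exists a positive semidefinite Gram matrix `Q` with rational entries."
* **Theorem 6** (`LDLᵀ`). "Let `Q` be a symmetric positive semidefinite `n × n` matrix. Then there
  exist a diagonal matrix `D`, a lower triangular matrix `L` with unit diagonal, and a nonsingular
  permutation matrix `P` such that `PᵀQP = LDLᵀ`. … The matrix `Q` is positive semidefinite if and
  only if all the diagonal elements `dᵢ` are nonnegative."

What the tree already had, and what this file adds.  `GramMatrixMethod` proves the Gram-matrix
method with the SOS conclusion over `ℝ` only (`isSumSq_gramPoly_of_posSemidef`, Laurent's Lemma 3.8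
`isSumSq_iff_exists_posSemidef`), and over ordered rings the `LDLᵀ` SHAPE lemmas
`gramPoly_sum_smul_vecMulVec` / `isSumSq_gramPoly_sum_smul_vecMulVec` ("if the weights are sums of
squares"); `RationalSosCertificate` / `Computation.Certificates.PosSemidef` give NONNEGATIVITY from an
exact rational Gram matrix.  The missing EXISTENCE half — a positive semidefinite matrix over an
ordered field IS a nonnegatively weighted sum of rank-one squares `Σ_l c_l v_l v_lᵀ`, so a rational
PSD Gram matrix yields a rational SOS certificate — is supplied here, on top of the tree's congruence
diagonalisation of symmetric matrices over a field of characteristic `≠ 2`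
(`Literature.NumberTheory.QuadraticForms.exists_congr_diagonal`, Serre Ch. IV §1.4), cited by name:

* §1 (any field with `2 ≠ 0`, any finite index type): `exists_eq_transpose_mul_diagonal_mul` — a
  symmetric `A` is `Bᵀ · diag(c) · B` with `B` invertible (the `LDLᵀ` shape of Thm 6; triangularity of
  the factor, an algorithmic convenience, is not asserted), and
  `transpose_mul_diagonal_mul_eq_sum_smul_vecMulVec` : `Bᵀ diag(c) B = Σ_l c_l • v_l v_lᵀ` (`v_l` = row
  `l` of `B`), the form `GramMatrixMethod.gramPoly_sum_smul_vecMulVec` consumes.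
* §2 (linearly ordered field): `dotProduct_mulVec_transpose_mul_diagonal_mul` (`xᵀ(BᵀDB)x =
  Σ_l c_l (Bx)_l²`), `weight_eq_dotProduct_mulVec` (`c_l = (P e_l)ᵀ A (P e_l)` for `BP = 1`), hence
  Theorem 6's decision sentence `dotProduct_mulVec_nonneg_iff_weights_nonneg` ("`Q` is positive
  semidefinite iff all `dᵢ` are nonnegative", for ANY invertible congruence diagonalisation), the
  existence statement `exists_nonneg_weights_of_dotProduct_mulVec_nonneg` and the characterisation
  `dotProduct_mulVec_nonneg_iff_exists_sum_smul_vecMulVec`; with Mathlib's `Matrix.PosSemidef` (trivial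
  `star`): `posSemidef_iff_exists_nonneg_weights`.
* §3 (`ℚ`): `isSumSq_rat_iff_nonneg` — a rational number is a sum of squares iff it is `≥ 0` (Mathlib's
  `Rat.addSubmonoid_closure_range_mul_self`, the step "`dᵢ = aᵢbᵢ/bᵢ²`").
* §4 (polynomials): `exists_gramPoly_eq_weighted_sos` — over a linearly ordered field a PSD Gram matrix
  writes `zᵀQz` as a WEIGHTED sum of squares with nonnegative weights (Prop. 4, proof);
  `isSumSq_gramPoly_of_posSemidef_rat` — over `ℚ` an honest sum of squares in `ℚ[x]` (Prop. 4, ⇐);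
  `isSumSq_iff_exists_posSemidef_rat` / `isSumSq_iff_exists_posSemidef_coeff_rat` — Proposition 4
  verbatim in Gram form and in the linear-system form (3.4) of [Laurent2008, Lemma 3.8], i.e. Lemma 3.8
  with `ℝ` replaced by `ℚ` throughout (polynomial, squares AND Gram matrix rational).

Why the engines lane types this: it is the completeness half of exact rational SOS certification — a
verifier that accepts "rational PSD Gram matrix + coefficient match" loses nothing against "explicit
rational squares", and an exact `LDLᵀ` over `ℚ` (all pivots `≥ 0`) is a complete decision for the PSD
test (cf. `Computation.Certificates.PsdZeroPivotRule` for the branch rules over `ℝ`).  The negative side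
— a polynomial with rational coefficients that is SOS over `ℝ` but has NO rational PSD Gram matrix — is
`ScheidererTernaryQuartic`.

## References

* [PeyrlParrilo2008] H. Peyrl, P. A. Parrilo, Theoret. Comput. Sci. 409 (2008) 269–281, §3 Prop. 4,
  Thm 6 (pp. 274–275).
* [Laurent2008] M. Laurent, *Sums of squares, moment matrices and optimization over polynomials*,
  IMA Vol. Math. Appl. 149 (2009) 157–270, §3.3 Lemma 3.8 and (3.4).
* [Serre1973] J.-P. Serre, *A Course in Arithmetic*, Ch. IV §1.4 (orthogonal bases), via
  `Literature.NumberTheory.QuadraticForms.exists_congr_diagonal`.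
-/

noncomputable section

open Matrix MvPolynomial Finset

open scoped BigOperators

namespace Literature.Algebra.Polynomial.OrderedFieldGramSos

open Literature.Algebra.Polynomial.GramMatrixMethod

universe u v w

variable {K : Type v} [Field K]
variable {k : Type w} [Fintype k] [DecidableEq k]

/-! ### §1. Congruence diagonalisation `A = Bᵀ · diag(c) · B` over a field with `2 ≠ 0` -/

section Shape

variable {R : Type v} [CommRing R]

omit [Fintype k] [DecidableEq k] in
/-- **The `LDLᵀ` shape as a sum of weighted rank-one squares**: `Bᵀ · diag(c) · B = Σ_l c_l • v_l v_lᵀ`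
with `v_l` the `l`-th row of `B` (entrywise `(Bᵀ diag(c) B)_{ij} = Σ_l c_l B_{li} B_{lj}`) — the form in
which `GramMatrixMethod.gramPoly_sum_smul_vecMulVec` reads a Gram matrix as the weighted sum of squares
`Σ_l c_l (v_l · z)²`. [cite: PeyrlParrilo2008, §3 proof of Prop. 4 ("zᵀQz = zᵀPᵀDPz = Σᵢ dᵢ (Pz)ᵢ²"), p. 274] -/
theorem transpose_mul_diagonal_mul_eq_sum_smul_vecMulVec {r : Type*} [Fintype r] [DecidableEq r]
    (B : Matrix r k R) (c : r → R) :
    Bᵀ * diagonal c * B = ∑ l, c l • vecMulVec (B l) (B l) := by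
  ext i j
  rw [Matrix.mul_apply, Matrix.sum_apply]
  refine Finset.sum_congr rfl fun l _ => ?_
  rw [Matrix.mul_diagonal, Matrix.transpose_apply]
  simp only [Matrix.smul_apply, vecMulVec_apply, smul_eq_mul]
  ring

end Shape

/-- **Congruence diagonalisation, `Fin n`-indexed** (the `LDLᵀ` shape of [PeyrlParrilo2008, Thm 6]
without the triangularity of the factor): over a field with `2 ≠ 0`, a symmetric matrix is
`A = Bᵀ · diag(c) · B` with `B` invertible (`BP = PB = 1`).  This is the tree's
orthogonal-basis theorem `Literature.NumberTheory.QuadraticForms.exists_congr_diagonal`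
(`PᵀAP = diag(c)`) read from the other side. [cite: PeyrlParrilo2008, §3 Thm 6 (p. 275); Serre1973, Ch. IV §1.4] -/
theorem exists_eq_transpose_mul_diagonal_mul_fin [NeZero (2 : K)] {n : ℕ}
    (A : Matrix (Fin n) (Fin n) K) (hA : A.IsSymm) :
    ∃ (B P : Matrix (Fin n) (Fin n) K) (c : Fin n → K),
      B * P = 1 ∧ P * B = 1 ∧ A = Bᵀ * diagonal c * B := by
  obtain ⟨P, Q, c, hPQ, hQP, hD, -⟩ :=
    Literature.NumberTheory.QuadraticForms.exists_congr_diagonal A hA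
  refine ⟨Q, P, c, hQP, hPQ, ?_⟩
  have hQPt : Qᵀ * Pᵀ = 1 := by rw [← Matrix.transpose_mul, hPQ, Matrix.transpose_one]
  calc A = (Qᵀ * Pᵀ) * A * (P * Q) := by rw [hQPt, hPQ, Matrix.one_mul, Matrix.mul_one]
    _ = Qᵀ * (Pᵀ * A * P) * Q := by simp only [Matrix.mul_assoc]
    _ = Qᵀ * diagonal c * Q := by rw [hD]

/-- **Congruence diagonalisation over any finite index type**: for a symmetric `A : Matrix k k K`
(`2 ≠ 0` in `K`) there are `B, P : Matrix k k K` and weights `c : k → K` with `BP = PB = 1` and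
`A = Bᵀ · diag(c) · B` (reindex `exists_eq_transpose_mul_diagonal_mul_fin` along `k ≃ Fin |k|`).
[cite: PeyrlParrilo2008, §3 Thm 6 (p. 275); Serre1973, Ch. IV §1.4] -/
theorem exists_eq_transpose_mul_diagonal_mul [NeZero (2 : K)] (A : Matrix k k K) (hA : A.IsSymm) :
    ∃ (B P : Matrix k k K) (c : k → K), B * P = 1 ∧ P * B = 1 ∧ A = Bᵀ * diagonal c * B := by
  set e := Fintype.equivFin k with he
  set A' : Matrix (Fin (Fintype.card k)) (Fin (Fintype.card k)) K := A.submatrix e.symm e.symm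
    with hA'
  have hA's : A'.IsSymm := hA.submatrix e.symm
  obtain ⟨B', P', c', hBP, hPB, hD⟩ := exists_eq_transpose_mul_diagonal_mul_fin A' hA's
  refine ⟨B'.submatrix e e, P'.submatrix e e, c' ∘ e, ?_, ?_, ?_⟩
  · rw [Matrix.submatrix_mul_equiv, hBP, Matrix.submatrix_one_equiv]
  · rw [Matrix.submatrix_mul_equiv, hPB, Matrix.submatrix_one_equiv]
  · have h1 : (B'.submatrix e e)ᵀ * diagonal (c' ∘ e) * B'.submatrix e e
        = (B'ᵀ * diagonal c' * B').submatrix e e := by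
      rw [Matrix.transpose_submatrix, ← Matrix.submatrix_diagonal_equiv,
        Matrix.submatrix_mul_equiv, Matrix.submatrix_mul_equiv]
    rw [h1, ← hD, hA', Matrix.submatrix_submatrix]
    simp

/-! ### §2. Ordered fields: nonnegative weights (Peyrl–Parrilo, Thm 6, "PSD iff all `dᵢ ≥ 0`") -/

section Ordered

variable [LinearOrder K] [IsStrictOrderedRing K]

omit [LinearOrder K] [IsStrictOrderedRing K] [DecidableEq k] in
/-- The quadratic form of `Bᵀ · diag(c) · B` is the weighted sum of squares of the coordinates of `Bx`:
`xᵀ (Bᵀ diag(c) B) x = Σ_l c_l (Bx)_l²`. [cite: PeyrlParrilo2008, §3 proof of Prop. 4 (p. 274)] -/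
theorem dotProduct_mulVec_transpose_mul_diagonal_mul {r : Type*} [Fintype r] [DecidableEq r]
    (B : Matrix r k K) (c : r → K) (x : k → K) :
    x ⬝ᵥ ((Bᵀ * diagonal c * B) *ᵥ x) = ∑ l, c l * ((B *ᵥ x) l * (B *ᵥ x) l) := by
  rw [← Matrix.mulVec_mulVec, ← Matrix.mulVec_mulVec, Matrix.dotProduct_mulVec,
    Matrix.vecMul_transpose]
  simp only [dotProduct, Matrix.mulVec_diagonal]
  exact Finset.sum_congr rfl fun l _ => by ring

omit [DecidableEq k] in
/-- Nonnegative weights make `Bᵀ · diag(c) · B` positive semidefinite as a quadratic form (the easy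
direction of [PeyrlParrilo2008, Thm 6]). [cite: PeyrlParrilo2008, §3 Thm 6 (p. 275)] -/
theorem dotProduct_mulVec_nonneg_of_weights_nonneg {r : Type*} [Fintype r] [DecidableEq r]
    (B : Matrix r k K) {c : r → K} (hc : ∀ l, 0 ≤ c l) (x : k → K) :
    0 ≤ x ⬝ᵥ ((Bᵀ * diagonal c * B) *ᵥ x) := by
  rw [dotProduct_mulVec_transpose_mul_diagonal_mul]
  exact Finset.sum_nonneg fun l _ => mul_nonneg (hc l) (mul_self_nonneg _)

omit [LinearOrder K] [IsStrictOrderedRing K] in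
/-- **Each weight is a value of the quadratic form**: if `BP = 1` then
`c_l = (P e_l)ᵀ (Bᵀ diag(c) B) (P e_l)`. [cite: PeyrlParrilo2008, §3 Thm 6 (p. 275)] -/
theorem weight_eq_dotProduct_mulVec (B P : Matrix k k K) (hBP : B * P = 1) (c : k → K) (l : k) :
    c l = (P *ᵥ Pi.single l 1) ⬝ᵥ ((Bᵀ * diagonal c * B) *ᵥ (P *ᵥ Pi.single l 1)) := by
  rw [dotProduct_mulVec_transpose_mul_diagonal_mul, Matrix.mulVec_mulVec, hBP, Matrix.one_mulVec]
  rw [Finset.sum_eq_single l]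
  · simp
  · intro m _ hml
    simp [hml]
  · intro h; exact absurd (Finset.mem_univ l) h

/-- **[PeyrlParrilo2008, Thm 6], decision sentence**: for ANY congruence diagonalisation
`A = Bᵀ · diag(c) · B` with `B` invertible (`BP = 1`), "the matrix `Q` is positive semidefinite if
and only if all the diagonal elements `dᵢ` are nonnegative" — the exact `LDLᵀ` PSD test over `ℚ`.
[cite: PeyrlParrilo2008, §3 Thm 6 (p. 275)] -/
theorem dotProduct_mulVec_nonneg_iff_weights_nonneg {A B P : Matrix k k K}
    {c : k → K} (hBP : B * P = 1) (hA : A = Bᵀ * diagonal c * B) :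
    (∀ x, 0 ≤ x ⬝ᵥ (A *ᵥ x)) ↔ ∀ l, 0 ≤ c l := by
  subst hA
  refine ⟨fun h l => ?_, fun hc x => dotProduct_mulVec_nonneg_of_weights_nonneg B hc x⟩
  rw [weight_eq_dotProduct_mulVec B P hBP c l]
  exact h _

/-- **Existence of a nonnegatively weighted diagonalisation** ([PeyrlParrilo2008, Thm 6] combined
with its decision sentence): a symmetric matrix over a linearly ordered field whose quadratic form is
nonnegative is `Bᵀ · diag(c) · B` with `B` invertible and ALL `c_l ≥ 0`.
[cite: PeyrlParrilo2008, §3 Thm 6 (p. 275)] -/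
theorem exists_nonneg_weights_of_dotProduct_mulVec_nonneg {A : Matrix k k K} (hA : A.IsSymm)
    (h : ∀ x, 0 ≤ x ⬝ᵥ (A *ᵥ x)) :
    ∃ (B P : Matrix k k K) (c : k → K),
      B * P = 1 ∧ P * B = 1 ∧ (∀ l, 0 ≤ c l) ∧ A = Bᵀ * diagonal c * B := by
  haveI : NeZero (2 : K) := ⟨two_ne_zero⟩
  obtain ⟨B, P, c, hBP, hPB, hD⟩ := exists_eq_transpose_mul_diagonal_mul A hA
  exact ⟨B, P, c, hBP, hPB, (dotProduct_mulVec_nonneg_iff_weights_nonneg hBP hD).1 h, hD⟩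

/-- **PSD quadratic forms are exactly the nonnegatively weighted sums of rank-one squares**
`A = Σ_l c_l • v_l v_lᵀ`, `c_l ≥ 0` (over a linearly ordered field; `|k|` terms suffice).
[cite: PeyrlParrilo2008, §3 proof of Prop. 4 and Thm 6 (pp. 274–275)] -/
theorem dotProduct_mulVec_nonneg_iff_exists_sum_smul_vecMulVec {A : Matrix k k K} (hA : A.IsSymm) :
    (∀ x, 0 ≤ x ⬝ᵥ (A *ᵥ x)) ↔
      ∃ (c : k → K) (v : k → k → K), (∀ l, 0 ≤ c l) ∧ A = ∑ l, c l • vecMulVec (v l) (v l) := by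
  constructor
  · intro h
    obtain ⟨B, P, c, -, -, hc, hD⟩ := exists_nonneg_weights_of_dotProduct_mulVec_nonneg hA h
    exact ⟨c, fun l => B l, hc, by rw [hD, transpose_mul_diagonal_mul_eq_sum_smul_vecMulVec]⟩
  · rintro ⟨c, v, hc, rfl⟩ x
    have : (∑ l, c l • vecMulVec (v l) (v l)) = (Matrix.of v)ᵀ * diagonal c * Matrix.of v :=
      (transpose_mul_diagonal_mul_eq_sum_smul_vecMulVec (Matrix.of v) c).symm
    rw [this]
    exact dotProduct_mulVec_nonneg_of_weights_nonneg _ hc x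

omit [IsStrictOrderedRing K] [DecidableEq k] in
/-- Over an ordered field with trivial involution, Mathlib's `Matrix.PosSemidef` is "symmetric with
nonnegative quadratic form". [folklore] -/
private theorem posSemidef_iff_isSymm_and [StarRing K] [TrivialStar K] (A : Matrix k k K) :
    A.PosSemidef ↔ A.IsSymm ∧ ∀ x, 0 ≤ x ⬝ᵥ (A *ᵥ x) := by
  rw [Matrix.posSemidef_iff_dotProduct_mulVec]
  refine and_congr ?_ (forall_congr' fun x => by rw [star_trivial])
  rw [Matrix.IsHermitian, conjTranspose_eq_transpose_of_trivial]
  rfl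

/-- **[PeyrlParrilo2008, Thm 6] for Mathlib's `Matrix.PosSemidef`** over a linearly ordered field
with trivial involution (`ℚ`, real algebraic numbers, `ℝ`): `A ⪰ 0` iff `A = Bᵀ · diag(c) · B` for
some invertible `B` and weights `c ≥ 0` — an exact `LDLᵀ`-type certificate exists for every PSD matrix,
so the exact test is complete. [cite: PeyrlParrilo2008, §3 Thm 6 (p. 275)] -/
theorem posSemidef_iff_exists_nonneg_weights [StarRing K] [TrivialStar K] (A : Matrix k k K) :
    A.PosSemidef ↔ ∃ (B P : Matrix k k K) (c : k → K),
      B * P = 1 ∧ P * B = 1 ∧ (∀ l, 0 ≤ c l) ∧ A = Bᵀ * diagonal c * B := by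
  rw [posSemidef_iff_isSymm_and]
  constructor
  · rintro ⟨hA, h⟩
    exact exists_nonneg_weights_of_dotProduct_mulVec_nonneg hA h
  · rintro ⟨B, P, c, hBP, -, hc, rfl⟩
    refine ⟨?_, fun x => dotProduct_mulVec_nonneg_of_weights_nonneg B hc x⟩
    change (Bᵀ * diagonal c * B)ᵀ = Bᵀ * diagonal c * B
    rw [Matrix.transpose_mul, Matrix.transpose_mul, Matrix.transpose_transpose, diagonal_transpose,
      Matrix.mul_assoc]

end Ordered

/-! ### §3. Nonnegative rationals are sums of squares (`dᵢ = aᵢbᵢ / bᵢ²`) -/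

/-- A rational number is a sum of squares of rationals iff it is nonnegative — the step
"`dᵢ = aᵢ/bᵢ = aᵢbᵢ/bᵢ²`, hence … a sum of at most `a₁b₁ + ⋯ + a_k b_k` squares" of
[PeyrlParrilo2008, proof of Prop. 4]; in Mathlib this is `Rat.addSubmonoid_closure_range_mul_self`.
[cite: PeyrlParrilo2008, §3 proof of Prop. 4 (p. 274)] -/
theorem isSumSq_rat_iff_nonneg (q : ℚ) : IsSumSq q ↔ 0 ≤ q := by
  refine ⟨IsSumSq.nonneg, fun hq => ?_⟩
  have hmem : q ∈ AddSubmonoid.closure (Set.range fun x : ℚ => x * x) := by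
    rw [Rat.addSubmonoid_closure_range_mul_self]; exact hq
  have hset : (Set.range fun x : ℚ => x * x) = {x : ℚ | IsSquare x} := by
    ext x
    simp only [Set.mem_range, Set.mem_setOf_eq, IsSquare]
    exact ⟨fun ⟨r, hr⟩ => ⟨r, hr.symm⟩, fun ⟨r, hr⟩ => ⟨r, hr.symm⟩⟩
  rw [hset, AddSubmonoid.closure_isSquare] at hmem
  exact AddSubmonoid.mem_sumSq.1 hmem

/-! ### §4. Gram matrices over ordered fields and over `ℚ`: Proposition 4 -/

section Polynomials

variable {σ : Type u}

/-- The image of a sum of squares under a ring homomorphism is a sum of squares. [folklore] -/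
private theorem isSumSq_map {R S : Type*} [CommSemiring R] [CommSemiring S] (f : R →+* S) {a : R}
    (ha : IsSumSq a) : IsSumSq (f a) := by
  induction ha with
  | zero => rw [map_zero]; exact IsSumSq.zero
  | sq_add a _ ih => simpa [map_add, map_mul] using IsSumSq.sq_add (f a) ih

omit [DecidableEq k] in
/-- **[PeyrlParrilo2008, Prop. 4], the diagonalisation step, over any linearly ordered field**: if the
Gram matrix `Q` is symmetric with nonnegative quadratic form then `zᵀQz` IS a weighted sum of squares
of `K`-linear combinations of the entries of `z` with NONNEGATIVE weights,
`zᵀQz = Σ_l c_l (Σ_j v_{lj} z_j)²`, `c_l ≥ 0` ("`p(x) = zᵀPᵀDPz = Σᵢ dᵢ (Pz)ᵢ²` … the rational weights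
`dᵢ` are nonnegative because `Q` was assumed to be positive semidefinite").
[cite: PeyrlParrilo2008, §3 Prop. 4 (proof, p. 274)] -/
theorem exists_gramPoly_eq_weighted_sos [LinearOrder K] [IsStrictOrderedRing K] {Q : Matrix k k K}
    (hQ : Q.IsSymm) (hpsd : ∀ x, 0 ≤ x ⬝ᵥ (Q *ᵥ x)) (z : k → MvPolynomial σ K) :
    ∃ (c : k → K) (v : k → k → K), (∀ l, 0 ≤ c l) ∧
      gramPoly Q z = ∑ l, C (c l) * ((∑ j, C (v l j) * z j) * (∑ j, C (v l j) * z j)) := by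
  classical
  obtain ⟨c, v, hc, hQ'⟩ := (dotProduct_mulVec_nonneg_iff_exists_sum_smul_vecMulVec hQ).1 hpsd
  exact ⟨c, v, hc, by rw [hQ', gramPoly_sum_smul_vecMulVec]⟩

/-- **[PeyrlParrilo2008, Prop. 4] (⇐): a rational positive semidefinite Gram matrix gives a rational
SOS decomposition.**  For `Q : Matrix k k ℚ` positive semidefinite and any vector `z` of rational
polynomials, `zᵀQz` is a sum of squares in `ℚ[x]` (diagonalise, then write each nonnegative rational
weight as a sum of squares). [cite: PeyrlParrilo2008, §3 Prop. 4 (p. 274)] -/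
theorem isSumSq_gramPoly_of_posSemidef_rat {Q : Matrix k k ℚ} (hQ : Q.PosSemidef)
    (z : k → MvPolynomial σ ℚ) : IsSumSq (gramPoly Q z) := by
  classical
  obtain ⟨hQs, hpsd⟩ := (posSemidef_iff_isSymm_and Q).1 hQ
  obtain ⟨c, v, hc, hQ'⟩ := (dotProduct_mulVec_nonneg_iff_exists_sum_smul_vecMulVec hQs).1 hpsd
  rw [hQ']
  exact isSumSq_gramPoly_sum_smul_vecMulVec (fun l => (isSumSq_rat_iff_nonneg _).2 (hc l)) v z

/-- **[PeyrlParrilo2008, Proposition 4], verbatim in Gram form** (= [Laurent2008, Lemma 3.8] with `ℝ`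
replaced by `ℚ` throughout).  Let `p ∈ ℚ[x₁,…,xₙ]` have degree `≤ 2d` and let `z_d` be the vector of
monomials of degree `≤ d`.  Then `p` is a sum of squares of polynomials WITH RATIONAL COEFFICIENTS iff
`p = z_dᵀ Q z_d` for some positive semidefinite matrix `Q` WITH RATIONAL ENTRIES.
[cite: PeyrlParrilo2008, §3 Prop. 4 (p. 274); Laurent2008, §3.3 Lemma 3.8] -/
theorem isSumSq_iff_exists_posSemidef_rat [Fintype σ] [DecidableEq σ] {p : MvPolynomial σ ℚ}
    {d : ℕ} (hp : p.totalDegree ≤ 2 * d) :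
    IsSumSq p ↔ ∃ Q : Matrix (monomialsLE σ d) (monomialsLE σ d) ℚ,
      Q.PosSemidef ∧ p = gramPoly Q (monomialVec (monomialsLE σ d)) := by
  constructor
  · intro h
    obtain ⟨m, u, hu, hdeg⟩ := exists_sum_mul_self_eq_of_isSumSq_of_totalDegree_le h hp
    refine ⟨(coeffMatrix u (monomialsLE σ d))ᵀ * coeffMatrix u (monomialsLE σ d), ?_, ?_⟩
    · simpa only [conjTranspose_eq_transpose_of_trivial] using
        posSemidef_conjTranspose_mul_self (coeffMatrix u (monomialsLE σ d))
    · rw [hu]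
      exact sum_mul_self_eq_gramPoly u _ fun j => support_subset_monomialsLE (hdeg j)
  · rintro ⟨Q, hQ, rfl⟩
    exact isSumSq_gramPoly_of_posSemidef_rat hQ _

/-- **[PeyrlParrilo2008, Proposition 4], linear-system form**: `p ∈ ℚ[x]` of degree `≤ 2d` is a
rational sum of squares iff the linear system `Σ_{β,γ ∈ ℕⁿ_d, β+γ=α} X_{βγ} = p_α` (all `α`;
[Laurent2008, (3.4)]) has a positive semidefinite RATIONAL solution `X` — the exact-arithmetic
semidefinite feasibility problem a rational SOS search decides.
[cite: PeyrlParrilo2008, §3 Prop. 4 (p. 274) with identity (3) (p. 272) and the coefficient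
equations (6) (p. 273); Laurent2008, §3.3 Lemma 3.8 (ii)] -/
theorem isSumSq_iff_exists_posSemidef_coeff_rat [Fintype σ] [DecidableEq σ] {p : MvPolynomial σ ℚ}
    {d : ℕ} (hp : p.totalDegree ≤ 2 * d) :
    IsSumSq p ↔ ∃ Q : Matrix (monomialsLE σ d) (monomialsLE σ d) ℚ, Q.PosSemidef ∧
      ∀ α, coeff α p = ∑ β : monomialsLE σ d, ∑ γ : monomialsLE σ d,
        if β.1 + γ.1 = α then Q β γ else 0 := by
  rw [isSumSq_iff_exists_posSemidef_rat hp]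
  refine exists_congr fun Q => and_congr_right fun _ => ?_
  simp_rw [← coeff_gramPoly_monomialVec]
  exact ⟨fun h α => by rw [h], fun h => MvPolynomial.ext _ _ h⟩

/-- **Rational SOS ⇒ nonnegative weights are not needed as data**: conversely to
`exists_gramPoly_eq_weighted_sos`, a weighted sum of squares with nonnegative rational weights is a
plain sum of squares in `ℚ[x]`. [cite: PeyrlParrilo2008, §3 proof of Prop. 4 ("Hence p(x) can be
written as a sum of at most a₁b₁ + ⋯ + a_k b_k squares in ℚ[x]"), p. 274] -/
theorem isSumSq_weighted_sos_rat {r : Type*} (s : Finset r) {c : r → ℚ} (hc : ∀ l ∈ s, 0 ≤ c l)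
    (u : r → MvPolynomial σ ℚ) : IsSumSq (∑ l ∈ s, C (c l) * (u l * u l)) := by
  refine IsSumSq.sum fun l hl => IsSumSq.mul ?_ (IsSumSq.mul_self _)
  exact isSumSq_map C ((isSumSq_rat_iff_nonneg (c l)).2 (hc l hl))

end Polynomials

/-! ### Tests -/

section Tests

/-- Usage: the `2 × 2` rational Gram matrix `[[2, 1], [1, 2]] ⪰ 0` (weights `2, 3/2` in its `LDLᵀ`)
turns `2 z₀² + 2 z₀ z₁ + 2 z₁²` into a rational sum of squares. -/
example (z : Fin 2 → MvPolynomial (Fin 2) ℚ) (hQ : (!![2, 1; 1, 2] : Matrix (Fin 2) (Fin 2) ℚ).PosSemidef) :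
    IsSumSq (gramPoly (!![2, 1; 1, 2] : Matrix (Fin 2) (Fin 2) ℚ) z) :=
  isSumSq_gramPoly_of_posSemidef_rat hQ z

/-- Usage of the decision sentence: with the explicit `LDLᵀ` data `B = [[1, 1/2], [0, 1]]`,
`P = B⁻¹ = [[1, -1/2], [0, 1]]`, `c = (2, 3/2)` of `[[2, 1], [1, 2]]`, nonnegativity of the quadratic
form is read off the two pivots. -/
example : ∀ x : Fin 2 → ℚ, 0 ≤ x ⬝ᵥ ((!![2, 1; 1, 2] : Matrix (Fin 2) (Fin 2) ℚ) *ᵥ x) := by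
  have hBP : (!![1, 1/2; 0, 1] : Matrix (Fin 2) (Fin 2) ℚ) * !![1, -1/2; 0, 1] = 1 := by
    ext i j; fin_cases i <;> fin_cases j <;> norm_num [Matrix.mul_apply, Fin.sum_univ_two]
  have hA : (!![2, 1; 1, 2] : Matrix (Fin 2) (Fin 2) ℚ)
      = (!![1, 1/2; 0, 1] : Matrix (Fin 2) (Fin 2) ℚ)ᵀ * diagonal ![2, 3/2] * !![1, 1/2; 0, 1] := by
    ext i j; fin_cases i <;> fin_cases j <;>
      norm_num [Matrix.mul_apply, Fin.sum_univ_two, diagonal, Matrix.of_apply]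
  refine (dotProduct_mulVec_nonneg_iff_weights_nonneg hBP hA).2 fun l => ?_
  fin_cases l <;> norm_num

end Tests

end Literature.Algebra.Polynomial.OrderedFieldGramSos
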